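import Summits.QuantumAdvantage.QuantumAdvantage.Theorems.ClassicalReplicaA
import HarnessLib

/-!
# Classical replica coupling (B1) — decomp-qadv lens-3 («MagnitudeDial» line), generation 29, part 2/3

**Theorem `moment_le`:** in the model of part A, for every randomized adaptive classical query
algorithm `A : σ → Strategy N` whose query marginals are `λ`-light at all levels `ℓ ≤ T`
(`cnt A ℓ j ≤ λ |σ| 2^N`), and every `m ≥ 1`,
`moment A T m ≤ λ^{m-1} · ∏_{i ∈ range m} (1 + i·T²) · |σ|^m · 2^N`,
where `moment A T m = Σ_y Σ_j n_y(j)^m`, `n_y(j) = nS A T y j = #{s : pos (A s) y T = j}`;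
i.e. `E_y Σ_j p_y(j)^m ≤ λ^{m-1} ∏_{i<m} (1 + i T²)` (CLASSICAL-HBR.md, Theorem 1, of the node
record `run/shared/lean/pub/decomp-qadv/decomp-qadv-lens-3/g29/`).  By Markov in `m` this gives the
exponential tail `P_y[max_j p_y(j) ≥ f] ≤ (e²/f) exp(-(f/λ)/(e(1+T²)))` (paper, Corollary 2 there).

Proof: `moment_one` (`= |σ| 2^N`) and the induction step
`moment_succ_le : moment A T (m+1) ≤ λ|σ|(1 + m T²) · moment A T m`, by the GROUP coupling:
`n^m = Σ_{v : Fin m → σ} ∏_i 1[pos_{v i} = j]` (`pow_nS_eq_sum_agreeV`, `Fintype.prod_sum`); the `m`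
old replicas share the source `yA` (revealed set `readSetV` = union of their read sets, `≤ m T`
positions, stable under gluing), so ANY such gluing is an involution of `Oracle × Oracle`
(`PhiR_involutive`, `sum_glueR`); the old replicas run on the glued oracle as on `yA`
(`pos_glueV_old`), the new replica runs as its free run on `yB` unless it attaches
(`pos_glueV_new`); the free term is `≤ L · Σ_j agreeV` by final-level lightness
(`sum_cnt_final_le`, `L = λ|σ|2^N`) and the attachment term is `≤ T · mT · L` (`sum_attach_le`).

This file (B1): generic stable gluing `glueR/PhiR_involutive/sum_glueR`, the tuple revealed set `readSetV`,
group gluing `glueV` and its lemmas, `nS/agreeV/moment` with `pow_nS_eq_sum_agreeV`, `moment_eq_sum_agreeV`,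
`moment_one`.  File B2: `sum_cnt_final_le`, `sum_attach_le`, `moment_succ_le`, `moment_le`.
-/

set_option linter.dupNamespace false

namespace Summit.QuantumAdvantage.QuantumAdvantage.Theorems.ClassicalReplica

open Finset

variable {N : ℕ} {σ : Type} [Fintype σ]

section GeneralGlue

/-- Gluing along an arbitrary revealed-set map `R`. -/
def glueR (R : Oracle N → Finset (Fin N)) (yA yB : Oracle N) : Oracle N :=
  fun j => if j ∈ R yA then yA j else yB j

/-- The complementary gluing (`yB` on the revealed set, `yA` elsewhere). -/
def mixR (R : Oracle N → Finset (Fin N)) (yA yB : Oracle N) : Oracle N :=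
  fun j => if j ∈ R yA then yB j else yA j

/-- The coupling map `(yA, yB) ↦ (glueR, mixR)`. -/
def PhiR (R : Oracle N → Finset (Fin N)) (p : Oracle N × Oracle N) : Oracle N × Oracle N :=
  (glueR R p.1 p.2, mixR R p.1 p.2)

/-- If the revealed set is stable under gluing, the coupling map is an involution. -/
theorem PhiR_involutive (R : Oracle N → Finset (Fin N))
    (hR : ∀ yA yB : Oracle N, R (glueR R yA yB) = R yA) : Function.Involutive (PhiR R) := by
  rintro ⟨yA, yB⟩
  have hR' : R (glueR R yA yB) = R yA := hR yA yB
  simp only [PhiR, Prod.mk.injEq]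
  refine ⟨?_, ?_⟩
  · funext j
    show (if j ∈ R (glueR R yA yB) then glueR R yA yB j else mixR R yA yB j) = yA j
    rw [hR']
    by_cases hj : j ∈ R yA
    · rw [if_pos hj]
      show (if j ∈ R yA then yA j else yB j) = yA j
      rw [if_pos hj]
    · rw [if_neg hj]
      show (if j ∈ R yA then yB j else yA j) = yA j
      rw [if_neg hj]
  · funext j
    show (if j ∈ R (glueR R yA yB) then mixR R yA yB j else glueR R yA yB j) = yB j
    rw [hR']
    by_cases hj : j ∈ R yA
    · rw [if_pos hj]
      show (if j ∈ R yA then yB j else yA j) = yB j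
      rw [if_pos hj]
    · rw [if_neg hj]
      show (if j ∈ R yA then yA j else yB j) = yB j
      rw [if_neg hj]

/-- Lazy-sampling identity for a stable revealed-set map: `Σ_{yA,yB} f(glue) = 2^N Σ_y f(y)`. -/
theorem sum_glueR (R : Oracle N → Finset (Fin N))
    (hR : ∀ yA yB : Oracle N, R (glueR R yA yB) = R yA) (f : Oracle N → ℝ) :
    ∑ yA : Oracle N, ∑ yB : Oracle N, f (glueR R yA yB) = (2 : ℝ) ^ N * ∑ y : Oracle N, f y := by
  have h1 : ∑ yA : Oracle N, ∑ yB : Oracle N, f (glueR R yA yB)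
      = ∑ p : Oracle N × Oracle N, f (PhiR R p).1 :=
    (Fintype.sum_prod_type' (fun a b => f (glueR R a b))).symm
  have h2 : ∑ p : Oracle N × Oracle N, f (PhiR R p).1 = ∑ p : Oracle N × Oracle N, f p.1 :=
    Equiv.sum_comp (Function.Involutive.toPerm (PhiR R) (PhiR_involutive R hR)) (fun q => f q.1)
  have h3 : ∑ p : Oracle N × Oracle N, f p.1 = ∑ y : Oracle N, ∑ _z : Oracle N, f y :=
    Fintype.sum_prod_type' (fun a _ => f a)
  rw [h1, h2, h3, Finset.mul_sum]
  refine Finset.sum_congr rfl fun y _ => ?_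
  rw [Finset.sum_const, Finset.card_univ, card_oracle, nsmul_eq_mul]
  push_cast
  ring

end GeneralGlue

section Replicas

variable (A : σ → Strategy N) (T : ℕ)

/-- The revealed set of a replica tuple: all positions read before query `T` by any of them. -/
def readSetV {m : ℕ} (v : Fin m → σ) (y : Oracle N) : Finset (Fin N) :=
  Finset.univ.biUnion fun i => readSet (A (v i)) y T

omit [Fintype σ] in
/-- Each replica's read set lies in the tuple's revealed set. -/
theorem readSet_subset_readSetV {m : ℕ} (v : Fin m → σ) (y : Oracle N) (i : Fin m) :
    readSet (A (v i)) y T ⊆ readSetV A T v y :=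
  Finset.subset_biUnion_of_mem (fun i => readSet (A (v i)) y T) (Finset.mem_univ i)

omit [Fintype σ] in
/-- A tuple of `m` replicas reveals at most `m T` positions. -/
theorem card_readSetV_le {m : ℕ} (v : Fin m → σ) (y : Oracle N) :
    (readSetV A T v y).card ≤ m * T := by
  unfold readSetV
  refine Finset.card_biUnion_le.trans ?_
  calc ∑ i : Fin m, (readSet (A (v i)) y T).card ≤ ∑ _i : Fin m, T :=
        Finset.sum_le_sum fun i _ => card_readSet_le (A (v i)) y T
    _ = m * T := by rw [Finset.sum_const, Finset.card_univ, Fintype.card_fin, smul_eq_mul]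

/-- Group gluing: `yA` on the tuple's revealed set, `yB` elsewhere. -/
def glueV {m : ℕ} (v : Fin m → σ) (yA yB : Oracle N) : Oracle N :=
  glueR (readSetV A T v) yA yB

omit [Fintype σ] in
/-- The tuple's revealed set is stable under group gluing. -/
theorem readSetV_glueV {m : ℕ} (v : Fin m → σ) (yA yB : Oracle N) :
    readSetV A T v (glueV A T v yA yB) = readSetV A T v yA := by
  unfold readSetV
  refine Finset.biUnion_congr rfl fun i _ => ?_
  exact readSet_congr (A (v i)) yA _ T fun i' hi' => by
    show (if pos (A (v i)) yA i' ∈ readSetV A T v yA then yA (pos (A (v i)) yA i')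
        else yB (pos (A (v i)) yA i')) = yA (pos (A (v i)) yA i')
    rw [if_pos (readSet_subset_readSetV A T v yA i (pos_mem_readSet (A (v i)) yA hi'))]

omit [Fintype σ] in
/-- Old replicas run on the glued oracle exactly as on `yA`, through query `T`. -/
theorem pos_glueV_old {m : ℕ} (v : Fin m → σ) (yA yB : Oracle N) (i : Fin m) {ℓ : ℕ}
    (hℓ : ℓ ≤ T) : pos (A (v i)) (glueV A T v yA yB) ℓ = pos (A (v i)) yA ℓ :=
  pos_congr (A (v i)) yA _ ℓ fun i' hi' => by
    show (if pos (A (v i)) yA i' ∈ readSetV A T v yA then yA (pos (A (v i)) yA i')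
        else yB (pos (A (v i)) yA i')) = yA (pos (A (v i)) yA i')
    rw [if_pos (readSet_subset_readSetV A T v yA i
      (pos_mem_readSet (A (v i)) yA (lt_of_lt_of_le hi' hℓ)))]

omit [Fintype σ] in
/-- The new replica runs on the glued oracle as its free run on `yB`, unless it attaches. -/
theorem pos_glueV_new {m : ℕ} (v : Fin m → σ) (B : Strategy N) (yA yB : Oracle N)
    (h : ∀ i' < T, pos B yB i' ∉ readSetV A T v yA) :
    pos B (glueV A T v yA yB) T = pos B yB T :=
  pos_congr B yB _ T fun i' hi' => by
    show (if pos B yB i' ∈ readSetV A T v yA then yA (pos B yB i') else yB (pos B yB i'))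
        = yB (pos B yB i')
    rw [if_neg (h i' hi')]

omit [Fintype σ] in
/-- Lazy-sampling identity for group gluing. -/
theorem sum_glueV {m : ℕ} (v : Fin m → σ) (f : Oracle N → ℝ) :
    ∑ yA : Oracle N, ∑ yB : Oracle N, f (glueV A T v yA yB) = (2 : ℝ) ^ N * ∑ y : Oracle N, f y :=
  sum_glueR (readSetV A T v) (readSetV_glueV A T v) f

/-- `n_y(j) = #{s : pos (A s) y T = j}`. -/
def nS (y : Oracle N) (j : Fin N) : ℝ := ∑ s : σ, if pos (A s) y T = j then 1 else 0

/-- Indicator that every replica of the tuple makes its final query at `j`. -/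
def agreeV {m : ℕ} (v : Fin m → σ) (y : Oracle N) (j : Fin N) : ℝ :=
  ∏ i : Fin m, if pos (A (v i)) y T = j then 1 else 0

/-- `Σ_y Σ_j n_y(j)^m = |σ|^m 2^N · E_y Σ_j p_y(j)^m`. -/
def moment (m : ℕ) : ℝ := ∑ y : Oracle N, ∑ j : Fin N, nS A T y j ^ m

omit [Fintype σ] in
/-- The agreement indicator is nonnegative. -/
theorem agreeV_nonneg {m : ℕ} (v : Fin m → σ) (y : Oracle N) (j : Fin N) :
    0 ≤ agreeV A T v y j :=
  Finset.prod_nonneg fun i _ => by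
    show (0:ℝ) ≤ (if pos (A (v i)) y T = j then 1 else 0)
    split_ifs <;> norm_num

omit [Fintype σ] in
/-- The agreement indicator is at most one. -/
theorem agreeV_le_one {m : ℕ} (v : Fin m → σ) (y : Oracle N) (j : Fin N) :
    agreeV A T v y j ≤ 1 :=
  Finset.prod_le_one (fun i _ => by
      show (0:ℝ) ≤ (if pos (A (v i)) y T = j then 1 else 0)
      split_ifs <;> norm_num)
    fun i _ => by
      show (if pos (A (v i)) y T = j then (1:ℝ) else 0) ≤ 1
      split_ifs <;> norm_num

/-- `n_y(j)^m = Σ_{v : Fin m → σ} ∏_i 1[pos_{v i} = j]` (replica expansion of a power). -/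
theorem pow_nS_eq_sum_agreeV (m : ℕ) (y : Oracle N) (j : Fin N) :
    nS A T y j ^ m = ∑ v : Fin m → σ, agreeV A T v y j := by
  rw [show nS A T y j ^ m = ∏ _i : Fin m, nS A T y j by
    rw [Finset.prod_const, Finset.card_univ, Fintype.card_fin]]
  unfold nS agreeV
  exact Fintype.prod_sum (fun (_ : Fin m) (s : σ) => if pos (A s) y T = j then (1:ℝ) else 0)

/-- The `m`-th moment as a sum over replica tuples. -/
theorem moment_eq_sum_agreeV (m : ℕ) :
    moment A T m = ∑ v : Fin m → σ, ∑ y : Oracle N, ∑ j : Fin N, agreeV A T v y j := by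
  unfold moment
  calc ∑ y : Oracle N, ∑ j : Fin N, nS A T y j ^ m
      = ∑ y : Oracle N, ∑ j : Fin N, ∑ v : Fin m → σ, agreeV A T v y j := by
        simp only [pow_nS_eq_sum_agreeV]
    _ = ∑ y : Oracle N, ∑ v : Fin m → σ, ∑ j : Fin N, agreeV A T v y j :=
        Finset.sum_congr rfl fun y _ => Finset.sum_comm
    _ = ∑ v : Fin m → σ, ∑ y : Oracle N, ∑ j : Fin N, agreeV A T v y j := Finset.sum_comm

/-- Moments are nonnegative. -/
theorem moment_nonneg (m : ℕ) : 0 ≤ moment A T m := by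
  rw [moment_eq_sum_agreeV]
  exact Finset.sum_nonneg fun v _ => Finset.sum_nonneg fun y _ =>
    Finset.sum_nonneg fun j _ => agreeV_nonneg A T v y j

/-- The first moment is `|σ| 2^N` (every seed makes exactly one final query). -/
theorem moment_one : moment A T 1 = (Fintype.card σ : ℝ) * 2 ^ N := by
  unfold moment nS
  have h : ∀ y : Oracle N,
      ∑ j : Fin N, (∑ s : σ, if pos (A s) y T = j then (1:ℝ) else 0) ^ 1 = Fintype.card σ := by
    intro y
    calc ∑ j : Fin N, (∑ s : σ, if pos (A s) y T = j then (1:ℝ) else 0) ^ 1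
        = ∑ j : Fin N, ∑ s : σ, (if pos (A s) y T = j then (1:ℝ) else 0) := by simp only [pow_one]
      _ = ∑ s : σ, ∑ j : Fin N, (if pos (A s) y T = j then (1:ℝ) else 0) := Finset.sum_comm
      _ = ∑ _s : σ, (1:ℝ) := Finset.sum_congr rfl fun s _ => by
            rw [Finset.sum_ite_eq]; simp
      _ = Fintype.card σ := by rw [Finset.sum_const, Finset.card_univ, nsmul_eq_mul, mul_one]
  simp only [h]
  rw [Finset.sum_const, Finset.card_univ, card_oracle, nsmul_eq_mul]
  push_cast
  ring

end Replicas

end Summit.QuantumAdvantage.QuantumAdvantage.Theorems.ClassicalReplica
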